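import Mathlib

/-!
# Segment subalgebra — the word-side engine of line `Sketch` for crux `ElementaryWordLength.WordPerCubic`

Crux stmt-ValiantsHypothesis-6625, line `Sketch` (idea `segment-jacobian`), stub S1 `stub_segmentSubalgebra`.

Fix a block predicate `p` on the variables `σ` and the block-split algebra map
`φ = aeval (v ↦ if p v then X v else C (X v)) : ℂ[x_σ] →ₐ[ℂ] (ℂ[x_σ])[x_σ]` (block variables stay outer
variables, all other variables become coefficients).  A word (list of letters `(i, j, c, v?)`, letter matrix
`E_ij(c · x_v)` resp. `E_ij(c)`) with `ℓ` letters carrying a `p`-variable factors as `M₀ E₁ M₁ ⋯ E_ℓ M_ℓ` with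
`p`-free segments `M_t` (matrices of coefficients).  We prove: every coefficient (w.r.t. the outer variables) of
every entry of the `φ`-image of the word's product lies in the `ℂ`-subalgebra of `ℂ[x_σ]` generated by at most
`9(ℓ + 1)` elements (the entries of the segments).  Proof: induction along the word with the invariant
`∏ = M.map C * Q`, `M` the open `p`-free segment, `Q` with coefficients in `adjoin (entries of closed segments)`.
-/

open MvPolynomial

-- `Summit.ValiantsHypothesis.ValiantsHypothesis.…` is the tree's mandated single-conjunct layout.
set_option linter.dupNamespace false

namespace Summit.ValiantsHypothesis.ValiantsHypothesis.Theorems.ElementaryWordLengthWordPerCubic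

section CoeffMem

variable {K R τ : Type*} [CommRing K] [CommRing R] [Algebra K R] [DecidableEq τ] (A : Subalgebra K R)

/-- Coefficients of a product stay in a subalgebra containing the coefficients of the factors. [folklore] -/
theorem seg_coeff_mul_mem {x y : MvPolynomial τ R} (hx : ∀ m, coeff m x ∈ A) (hy : ∀ m, coeff m y ∈ A)
    (m : τ →₀ ℕ) : coeff m (x * y) ∈ A := by
  rw [coeff_mul]
  exact sum_mem fun d _ => mul_mem (hx _) (hy _)

omit [DecidableEq τ] in
/-- Coefficients of a sum stay in a subalgebra containing the coefficients of the summands. [folklore] -/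
theorem seg_coeff_add_mem {x y : MvPolynomial τ R} (hx : ∀ m, coeff m x ∈ A) (hy : ∀ m, coeff m y ∈ A)
    (m : τ →₀ ℕ) : coeff m (x + y) ∈ A := by
  rw [coeff_add]
  exact add_mem (hx _) (hy _)

omit [DecidableEq τ] in
/-- Coefficients of a finite sum stay in a subalgebra containing the coefficients of the summands. [folklore] -/
theorem seg_coeff_sum_mem {ι : Type*} (t : Finset ι) {x : ι → MvPolynomial τ R}
    (hx : ∀ i ∈ t, ∀ m, coeff m (x i) ∈ A) (m : τ →₀ ℕ) : coeff m (∑ i ∈ t, x i) ∈ A := by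
  rw [coeff_sum]
  exact sum_mem fun i hi => hx i hi m

/-- The coefficients of a constant `C r`, `r ∈ A`, lie in `A`. [folklore] -/
theorem seg_coeff_C_mem {r : R} (hr : r ∈ A) (m : τ →₀ ℕ) :
    coeff m (C r : MvPolynomial τ R) ∈ A := by
  rw [coeff_C]
  split_ifs
  · exact hr
  · exact zero_mem _

/-- The coefficients of a variable lie in any subalgebra. [folklore] -/
theorem seg_coeff_X_mem (v : τ) (m : τ →₀ ℕ) : coeff m (X v : MvPolynomial τ R) ∈ A := by
  rw [coeff_X]
  split_ifs
  · exact one_mem _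
  · exact zero_mem _

/-- The coefficients of `1` lie in any subalgebra. [folklore] -/
theorem seg_coeff_one_mem (m : τ →₀ ℕ) : coeff m (1 : MvPolynomial τ R) ∈ A := by
  rw [coeff_one]
  split_ifs
  · exact one_mem _
  · exact zero_mem _

/-- Entries of a product of matrices whose entries have coefficients in `A` have coefficients in `A`. [folklore] -/
theorem seg_matrix_mul_mem {n : Type*} [Fintype n] {P Q : Matrix n n (MvPolynomial τ R)}
    (hP : ∀ i j m, coeff m (P i j) ∈ A) (hQ : ∀ i j m, coeff m (Q i j) ∈ A) (i j : n) (m : τ →₀ ℕ) :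
    coeff m ((P * Q) i j) ∈ A := by
  rw [Matrix.mul_apply]
  exact seg_coeff_sum_mem A _ (fun k _ => seg_coeff_mul_mem A (hP i k) (hQ k j)) m

/-- Entries of a transvection `1 + c • e_ij` have coefficients in `A` as soon as `c` does. [folklore] -/
theorem seg_transvection_mem {n : Type*} [DecidableEq n] (i j : n) {c : MvPolynomial τ R}
    (hc : ∀ m, coeff m c ∈ A) (a b : n) (m : τ →₀ ℕ) :
    coeff m (Matrix.transvection i j c a b) ∈ A := by
  simp only [Matrix.transvection, Matrix.add_apply, Matrix.one_apply, Matrix.single_apply]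
  refine seg_coeff_add_mem A (fun m => ?_) (fun m => ?_) m
  · split_ifs
    · exact seg_coeff_one_mem A m
    · rw [coeff_zero]; exact zero_mem _
  · split_ifs
    · exact hc m
    · rw [coeff_zero]; exact zero_mem _

/-- Entries of `M.map C` have coefficients in `A` when the entries of `M` lie in `A`. [folklore] -/
theorem seg_mapC_mem {n : Type*} {M : Matrix n n R} (hM : ∀ a b, M a b ∈ A) (a b : n)
    (m : τ →₀ ℕ) : coeff m ((M.map (C : R → MvPolynomial τ R)) a b) ∈ A := by
  rw [Matrix.map_apply]
  exact seg_coeff_C_mem A (hM a b) m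

end CoeffMem

/-- A ring map acts on a transvection through its scalar. [folklore] -/
theorem seg_transvection_map {R S n F : Type*} [CommRing R] [CommRing S] [DecidableEq n]
    [FunLike F R S] [RingHomClass F R S] (f : F) (i j : n) (c : R) :
    (Matrix.transvection i j c).map f = Matrix.transvection i j (f c) := by
  ext a b
  simp only [Matrix.map_apply, Matrix.transvection, Matrix.add_apply, Matrix.one_apply,
    Matrix.single_apply, map_add]
  split_ifs <;> simp

section Main

variable {σ : Type} [DecidableEq σ] (p : σ → Prop) [DecidablePred p]

/-- The invariant of the segment decomposition: the `φ`-image of the product of a word is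
`M.map C * Q` with `M` a matrix of coefficients (the open `p`-free segment) and `Q` a matrix whose
entries have all coefficients in the subalgebra generated by a set of at most `9 ℓ` coefficients,
`ℓ` the number of `p`-letters. [folklore] -/
theorem seg_invariant (w : List (Fin 3 × Fin 3 × ℂ × Option σ)) :
    ∃ (s : Finset (MvPolynomial σ ℂ)) (M : Matrix (Fin 3) (Fin 3) (MvPolynomial σ ℂ))
      (Q : Matrix (Fin 3) (Fin 3) (MvPolynomial σ (MvPolynomial σ ℂ))),
      s.card ≤ 9 * w.countP (fun l => l.2.2.2.any (fun v => decide (p v))) ∧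
      (∀ i j m, coeff m (Q i j) ∈ Algebra.adjoin ℂ (↑s : Set (MvPolynomial σ ℂ))) ∧
      (w.map (fun l => (Matrix.transvection l.1 l.2.1 (C l.2.2.1 * l.2.2.2.elim 1 X)).map
        (aeval (fun v : σ => if p v then (X v : MvPolynomial σ (MvPolynomial σ ℂ))
          else C (X v))))).prod = M.map C * Q := by
  induction w with
  | nil =>
    refine ⟨∅, 1, 1, by simp, fun i j m => ?_, ?_⟩
    · simp only [Matrix.one_apply]
      split_ifs
      · exact seg_coeff_one_mem _ m
      · rw [coeff_zero]; exact zero_mem _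
    · rw [Matrix.map_one _ (map_zero _) (map_one _), Matrix.one_mul, List.map_nil, List.prod_nil]
  | cons l w ih =>
    obtain ⟨s, M, Q, hs, hQ, hprod⟩ := ih
    -- the scalar of the letter and its image under the block split
    set φ : MvPolynomial σ ℂ →ₐ[ℂ] MvPolynomial σ (MvPolynomial σ ℂ) :=
      aeval (fun v : σ => if p v then (X v : MvPolynomial σ (MvPolynomial σ ℂ)) else C (X v)) with hφ
    have hφC : ∀ c : ℂ, φ (C c) = C (C c) := fun c => by
      rw [hφ, aeval_C]; rfl
    by_cases hB : (l.2.2.2.any (fun v => decide (p v))) = true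
    · -- a block letter closes the open segment
      obtain ⟨v, hv, hpv⟩ : ∃ v, l.2.2.2 = some v ∧ p v := by
        rcases h : l.2.2.2 with _ | v
        · simp [h] at hB
        · exact ⟨v, rfl, by simpa [h] using hB⟩
      classical
      refine ⟨s ∪ Finset.univ.image (fun ab : Fin 3 × Fin 3 => M ab.1 ab.2), 1,
        (Matrix.transvection l.1 l.2.1 (C l.2.2.1 * l.2.2.2.elim 1 X)).map φ * (M.map C * Q),
        ?_, ?_, ?_⟩
      · rw [List.countP_cons_of_pos (p := fun l : Fin 3 × Fin 3 × ℂ × Option σ =>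
          l.2.2.2.any (fun v => decide (p v))) hB]
        calc (s ∪ Finset.univ.image (fun ab : Fin 3 × Fin 3 => M ab.1 ab.2)).card
            ≤ s.card + (Finset.univ.image (fun ab : Fin 3 × Fin 3 => M ab.1 ab.2)).card :=
              Finset.card_union_le _ _
          _ ≤ 9 * w.countP (fun l => l.2.2.2.any (fun v => decide (p v))) + 9 := by
              gcongr
              exact (Finset.card_image_le).trans (by simp)
          _ = 9 * (w.countP (fun l => l.2.2.2.any (fun v => decide (p v))) + 1) := by ring
      · set s' := s ∪ Finset.univ.image (fun ab : Fin 3 × Fin 3 => M ab.1 ab.2) with hs'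
        have hA : Algebra.adjoin ℂ (↑s : Set (MvPolynomial σ ℂ)) ≤ Algebra.adjoin ℂ ↑s' :=
          Algebra.adjoin_mono (by rw [hs', Finset.coe_union]; exact Set.subset_union_left)
        have hM : ∀ a b, M a b ∈ Algebra.adjoin ℂ (↑s' : Set (MvPolynomial σ ℂ)) := fun a b =>
          Algebra.subset_adjoin (by
            rw [hs', Finset.coe_union]
            exact Set.mem_union_right _ (by simp))
        refine seg_matrix_mul_mem _ ?_ (seg_matrix_mul_mem _ (seg_mapC_mem _ hM)
          (fun i j m => hA (hQ i j m)))
        rw [seg_transvection_map]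
        refine seg_transvection_mem _ _ _ (fun m => ?_)
        rw [hv, Option.elim_some, map_mul, hφC, hφ, aeval_X, if_pos hpv, coeff_C_mul]
        exact mul_mem (Subalgebra.algebraMap_mem _ _) (seg_coeff_X_mem _ v m)
      · rw [List.map_cons, List.prod_cons, hprod, Matrix.map_one _ (map_zero _) (map_one _), Matrix.one_mul]
    · -- a block-free letter extends the open segment
      have hfree : φ (C l.2.2.1 * l.2.2.2.elim 1 X) = C (C l.2.2.1 * l.2.2.2.elim 1 X) := by
        rcases h : l.2.2.2 with _ | v
        · simp [hφC]
        · have hpv : ¬ p v := by simpa [h] using hB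
          rw [Option.elim_some, map_mul, map_mul, hφC, hφ, aeval_X, if_neg hpv]
      refine ⟨s, Matrix.transvection l.1 l.2.1 (C l.2.2.1 * l.2.2.2.elim 1 X) * M, Q, ?_, hQ, ?_⟩
      · rw [List.countP_cons_of_neg (p := fun l : Fin 3 × Fin 3 × ℂ × Option σ =>
          l.2.2.2.any (fun v => decide (p v))) hB]; exact hs
      · rw [List.map_cons, List.prod_cons, hprod, Matrix.map_mul, ← Matrix.mul_assoc,
          seg_transvection_map, seg_transvection_map, hfree]

end Main

/-- S1 — **segment subalgebra** (word-side engine of line `Sketch`, crux `WordPerCubic`): for a block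
predicate `p` and any list of letters, all coefficients (w.r.t. the block variables) of all entries of the
block-split product lie in a subalgebra of `ℂ[x]` generated by at most `9·(ℓ_p + 1)` elements, `ℓ_p` the
number of letters carrying a `p`-variable. [folklore] -/
theorem stub_segmentSubalgebra {σ : Type} [DecidableEq σ] (p : σ → Prop) [DecidablePred p]
    (w : List (Fin 3 × Fin 3 × ℂ × Option σ)) :
    ∃ s : Finset (MvPolynomial σ ℂ),
      s.card ≤ 9 * (w.countP (fun l => l.2.2.2.any (fun v => decide (p v))) + 1) ∧
      ∀ (i j : Fin 3) (m : σ →₀ ℕ),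
        coeff m ((((w.map (fun l => Matrix.transvection l.1 l.2.1
          (C l.2.2.1 * l.2.2.2.elim 1 X))).prod).map
          (aeval (fun v : σ => if p v then (X v : MvPolynomial σ (MvPolynomial σ ℂ))
            else C (X v)))) i j) ∈ Algebra.adjoin ℂ (↑s : Set (MvPolynomial σ ℂ)) := by
  classical
  obtain ⟨s, M, Q, hs, hQ, hprod⟩ := seg_invariant p w
  set φ : MvPolynomial σ ℂ →ₐ[ℂ] MvPolynomial σ (MvPolynomial σ ℂ) :=
    aeval (fun v : σ => if p v then (X v : MvPolynomial σ (MvPolynomial σ ℂ)) else C (X v)) with hφ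
  have key : ((w.map (fun l => Matrix.transvection l.1 l.2.1 (C l.2.2.1 * l.2.2.2.elim 1 X))).prod).map φ
      = (w.map (fun l => (Matrix.transvection l.1 l.2.1 (C l.2.2.1 * l.2.2.2.elim 1 X)).map φ)).prod := by
    have h := map_list_prod φ.mapMatrix
      (w.map (fun l => Matrix.transvection l.1 l.2.1 (C l.2.2.1 * l.2.2.2.elim 1 X)))
    simpa [AlgHom.mapMatrix_apply, List.map_map, Function.comp_def] using h
  set s' := s ∪ Finset.univ.image (fun ab : Fin 3 × Fin 3 => M ab.1 ab.2) with hs'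
  refine ⟨s', ?_, fun i j m => ?_⟩
  · calc s'.card ≤ s.card + (Finset.univ.image (fun ab : Fin 3 × Fin 3 => M ab.1 ab.2)).card :=
          Finset.card_union_le _ _
      _ ≤ 9 * w.countP (fun l => l.2.2.2.any (fun v => decide (p v))) + 9 := by
          gcongr
          exact (Finset.card_image_le).trans (by simp)
      _ = 9 * (w.countP (fun l => l.2.2.2.any (fun v => decide (p v))) + 1) := by ring
  · have hA : Algebra.adjoin ℂ (↑s : Set (MvPolynomial σ ℂ)) ≤ Algebra.adjoin ℂ ↑s' :=
      Algebra.adjoin_mono (by rw [hs', Finset.coe_union]; exact Set.subset_union_left)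
    have hM : ∀ a b, M a b ∈ Algebra.adjoin ℂ (↑s' : Set (MvPolynomial σ ℂ)) := fun a b =>
      Algebra.subset_adjoin (by
        rw [hs', Finset.coe_union]
        exact Set.mem_union_right _ (by simp))
    rw [key, hprod]
    exact seg_matrix_mul_mem _ (seg_mapC_mem _ hM) (fun i j m => hA (hQ i j m)) i j m

end Summit.ValiantsHypothesis.ValiantsHypothesis.Theorems.ElementaryWordLengthWordPerCubic
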